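import Summits.QuantumFields.YangMills.Theorems.FluctuationComparisonRegPrIntLS1aCentreLegSurjective
import Summits.QuantumFields.YangMills.Theorems.UnitScaleTiltFluctuationComparisonRegPrOneStepSubmersion
import HarnessLib

/-!
# Route `UnitScaleTilt`, crux K1b-INT `FluctuationComparisonRegPrIntL` (stmt-QuantumFields-20520) — S1aᴴ `RunClassMembershipH`, conjuncts (a)∕(c):
# THE MEMBER-LOOP MAP IS OPEN ALONG THE FIBRES OF BAŁABAN'S (0.4) AVERAGING AT SMALL FIELDS — (T⊥)(ii) of UV3-NODE §67.7–§67.9 (`SU(2)`),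
# chart-free: near a small field every nearby value of a non-central member loop variable is attained INSIDE the fibre `{Ū = const}`

Cell `ym3-torus` (rung R3: SU(2) YM₃ on T³ — NOT d = 4, NOT infinite volume, NOT a mass gap, NOT Clay), width seat `ym3-torus-px13` g24
(`--supports stmt-QuantumFields-20520`, def-free).  FILE 4 of the centre-leg series (✓p820456 `…S1aCentreLegOccurrence`, ✓p820802
`…S1aCentreLegResponse`, ✓p821306 `…S1aCentreLegSurjective`, ✓p821341 `…S1aCentreLegInverseLipschitz`); UV3-NODE §78.
WHY.  §67.7 (px20 g20) reduced the existence half of S1aᴴ's analyticity conjunct (a) and the continuity conjunct (c) for the sharply cut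
densities of the (0.4) cascade to a TRANSVERSALITY lemma (T⊥); §78 (px13 g24): in the resampling coordinates of ✓`…SubmersionEngine` only the
PRIVATE-READING targets need it, and at small fields it is (FIB) + the centre-leg engine + bookkeeping — this file, for the member loops.
THE CONSTRUCTION ([folklore]; every analytic input is a landed theorem).  Given `x` near `loopHol U c i`: (1) DRIVER — move the private bond
`β(c)` by `g_β := pre⁻¹·(x⁻¹·loopHol U c i)·pre`; a NON-central member's open holonomy does not see `β(c)` and `U(c) = pre·U(β(c))·post`
(`BlockAveragingHaarAC` FACT (A)∕(B)), so the loop variable becomes `loopHol U c i · pre·g_β⁻¹·pre⁻¹ = x` while among the averages only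
`Ū(c)` moves; (2) CENTRE LEG — restore `Ū(c)` exactly by `e′ = ⟨emb c₋, ν⟩` (✓`centreLeg_surjective` at the moved background; the member does
not read `e′` when its staircase does not start with `+e_ν`; `e′` is not a private bond); (3) PRIVATE BONDS — restore every other `Ū(c″)` by
`β(c″)` (✓`OneStepSubmersion.fibrewise_avgFun`, robust for environments near `U`), invisible to `Ū(c)`, to one another and to the member.
All moves are bondwise `< ε` once `‖x − loopHol U c i‖ < min(s, η₁)` (`s` an explicit slack, `η₁` from ✓`continuousAt_avgFun_apply`).
WHAT THIS FILE PROVES (`Params` arbitrary in the standing range): §1 `loopHol_congr_off_private`, `avgFun_congr_off_private` (any group),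
`loopHol_update_centralBond_self`, `loopHol_of_isCentral`, `dist1_loopHol_update_centralBond_le`, `centreLeg_ne_centralBond`; §2
`exists_box_subset_of_mem_nhds` (uniform bondwise boxes inside neighbourhoods); §3 `norm_inv_mul_sub_one`, `norm_mul_sub_self_le`,
★★★ `loopHol_fibre_locally_onto` — for `U` `δ₁`-small (`((d+2)L)²δ₁∕4 < δ₂`) with loop variables at `c` within `α` (`α < 1∕24`, `α < δ₂∕2`,
`800ℓα < κ`, `κ = s′∕|I|`), a non-central member `i` whose staircase does not start with `+e_ν` (`ν ≠ c.dir`), every `ε > 0`: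
**`∃ η > 0, ∀ x, ‖x − loopHol U c i‖ < η → ∃ U′, (∀ b, ‖U′(b) − U(b)‖ < ε) ∧ Ū(U′) = Ū(U) ∧ loopHol U′ c i = x`** (`Ū = avgFun expMeanLogSU`).
(For `d ≥ 3` every non-central member avoids `S′(ν)` for some `ν ≠ c.dir`; the `2(d−1)` central-edge plaquettes per coarse bond are the other
private-reading targets — same construction, not in this file.)  One decl-local `maxHeartbeats 400000` on the main theorem (README rule).
HONEST SCOPE.  Bookkeeping over landed theorems; nothing of Bałaban's beyond ✓`norm_avgFun_ratio_sub_one_sub_covLinAvg_le`; the CONSUMERS of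
(T⊥) (S1aᴴ (a)∕(c) suppliers, (C-an), (C-size)) are NOT here; S1aᴴ, the five registered stubs, crux 20520, `YM3TorusSU2` NOT proved; the
Yang–Mills mass gap is NOT proved.
-/

set_option autoImplicit false

noncomputable section

open scoped Matrix.Norms.L2Operator Topology
open Filter Function

namespace Summit.QuantumFields.YangMills.Theorems.FluctuationComparisonRegPrIntLS1aFibreOpenMember

open Literature.MathematicalPhysics.QuantumFieldTheory.Balaban1983to89
open T4Continuum AveragingRT BlockAveraging ExpMeanLog BlockAveragingHaarAC
open Summit.QuantumFields.YangMills.Theorems.FluctuationComparisonRegPrIntLS1aCentreLegOccurrence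
open Summit.QuantumFields.YangMills.Theorems.FluctuationComparisonRegPrIntLS1aCentreLegResponse
open Summit.QuantumFields.YangMills.Theorems.FluctuationComparisonRegPrIntLS1aCentreLegSurjective

/-! ## §1 Private-coordinate bookkeeping: congruences, the driver formula, the centre leg is not private -/

section Private

variable {P : Params} {j : ℕ} {G : Type*} [GaugeGroup G]

/-- Two fields that agree on every bond except possibly at the central crossing bonds `β(c‴)` of coarse bonds `c‴ ≠ c″` have the
same loop variables at `c″` (FACT (A): `β(c‴)` is a bond of a loop word at `c″` only for `c‴ = c″`). [folklore] -/
theorem loopHol_congr_off_private (hj : j + 1 ≤ P.m + P.K) (U U' : GaugeField P j G) (c'' : PBond P (j + 1))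
    (h : ∀ b : PBond P j, (∀ c''' : PBond P (j + 1), b = centralBond c''' → c''' = c'') → U b = U' b) (i : Idx P) :
    loopHol U c'' i = loopHol U' c'' i := by
  unfold loopHol
  exact T4ReflectionCone.holAt_congr fun s hs => h _ fun c''' hsc => eq_of_mem_walk_loopWord_of_eq_centralBond hj c'' c''' i hs hsc

/-- The same for the whole (0.4) average at `c″` (loop variables and the line of `c″`). [folklore] -/
theorem avgFun_congr_off_private (hj : j + 1 ≤ P.m + P.K) (ℰ : LoopAverage G) (U U' : GaugeField P j G)
    (c'' : PBond P (j + 1))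
    (h : ∀ b : PBond P j, (∀ c''' : PBond P (j + 1), b = centralBond c''' → c''' = c'') → U b = U' b) :
    avgFun ℰ U c'' = avgFun ℰ U' c'' := by
  have hloop : loopHol U c'' = loopHol U' c'' := funext fun i => loopHol_congr_off_private hj U U' c'' h i
  have hax : axialAvg U c'' = axialAvg U' c'' := by
    rw [axialAvg_eq_holAt_walk, axialAvg_eq_holAt_walk]
    exact T4ReflectionCone.holAt_congr fun s hs => h _ fun c''' hsc => eq_of_mem_walk_line_of_eq_centralBond hj c'' c''' hs hsc
  show corr ℰ U c'' * axialAvg U c'' = corr ℰ U' c'' * axialAvg U' c''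
  have hcorr : corr ℰ U c'' = corr ℰ U' c'' := by unfold corr BlockAveraging.Small; rw [hloop]
  rw [hcorr, hax]

/-- **THE DRIVER FORMULA.**  For a NON-central member `i`, moving the private bond `U(β(c)) ↦ g·U(β(c))` multiplies the loop variable
on the RIGHT by `pre · g⁻¹ · pre⁻¹` (the open holonomy does not see `β(c)`; `U(c) = pre·U(β(c))·post`). [folklore] -/
theorem loopHol_update_centralBond_self [DecidableEq (PBond P j)] (hj : j + 1 ≤ P.m + P.K) (U : GaugeField P j G) (c : PBond P (j + 1)) (i : Idx P)
    (hi : ¬ IsCentral c i) (g : G) :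
    loopHol (update U (centralBond c) (g * U (centralBond c))) c i = loopHol U c i * (pre U c * g⁻¹ * (pre U c)⁻¹) := by
  rw [loopHol_eq_openHol_mul, loopHol_eq_openHol_mul, openHol_update_of_not_isCentral hj U c i hi,
    axialAvg_update_centralBond hj, axialAvg_eq_pre_mul_mul_post]
  group

/-- For a CENTRAL member the loop variable is identically `1` (the loop backtracks). [folklore] -/
theorem loopHol_of_isCentral (U : GaugeField P j G) (c : PBond P (j + 1)) (i : Idx P) (hi : IsCentral c i) :
    loopHol U c i = 1 := by
  rw [loopHol_eq_openHol_mul, openHol_of_isCentral U c i hi, mul_inv_cancel]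

/-- Moving the private bond by `g` moves each loop variable at `c` by at most `dist1 g`. [folklore] -/
theorem dist1_loopHol_update_centralBond_le [DecidableEq (PBond P j)] (hj : j + 1 ≤ P.m + P.K) (U : GaugeField P j G) (c : PBond P (j + 1)) (g : G)
    (i : Idx P) : dist1 (loopHol (update U (centralBond c) (g * U (centralBond c))) c i) ≤ dist1 g + dist1 (loopHol U c i) := by
  by_cases hi : IsCentral c i
  · rw [loopHol_of_isCentral _ c i hi, loopHol_of_isCentral _ c i hi, GaugeGroup.dist1_one]
    have := GaugeGroup.dist1_nonneg g; linarith
  · rw [loopHol_update_centralBond_self hj U c i hi]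
    calc _ ≤ dist1 (loopHol U c i) + dist1 (pre U c * g⁻¹ * (pre U c)⁻¹) := GaugeGroup.dist1_mul_le _ _
      _ = dist1 g + dist1 (loopHol U c i) := by rw [GaugeGroup.dist1_conj, GaugeGroup.dist1_inv, add_comm]

/-- **THE CENTRE LEG IS NOT A PRIVATE BOND**: `⟨emb c₋, ν⟩ ≠ β(c‴)` for every coarse bond `c‴` (the central crossing bonds sit at
longitudinal offset `h ≥ 1` from a block centre; the centre leg issues from a centre). [folklore] -/
theorem centreLeg_ne_centralBond (hj : j + 1 ≤ P.m + P.K) (c c''' : PBond P (j + 1)) (ν : Fin P.d) :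
    (⟨emb c.src, ν⟩ : PBond P j) ≠ centralBond c''' := by
  intro h
  have hL := two_mul_half_add_one P
  have hL1 := P.hL.2
  have hdir : ν = c'''.dir := (PBond.mk.injEq _ _ _ _ ▸ h :).2
  have hsrc : emb c.src = lineSite c''' ((P.L - 1) / 2) := (PBond.mk.injEq _ _ _ _ ▸ h :).1
  have hν := congrFun hsrc c'''.dir
  rw [lineSite_apply_int, if_pos rfl] at hν
  have h0 : emb c.src c'''.dir + ((0 : ℤ) : ZMod (P.sitesPerDir j)) =
      emb c'''.src c'''.dir + ((((P.L - 1) / 2 : ℕ) : ℤ) : ZMod (P.sitesPerDir j)) := by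
    rw [Int.cast_zero, add_zero, hν]
  have hdvd := L_dvd_of_emb_add_eq hj h0
  have := eq_zero_of_L_dvd (P := P) hdvd (by omega) (by omega)
  omega

end Private

/-! ## §2 Uniform boxes inside neighbourhoods of a configuration -/

section Boxes

variable {P : Params} {j : ℕ}

/-- Every neighbourhood of a configuration contains a UNIFORM box `{U′ | ∀ b, ‖U′(b) − U(b)‖ < ε₀}` (finitely many bonds, product
topology). [folklore] -/
theorem exists_box_subset_of_mem_nhds {U : GaugeField P j (Matrix.specialUnitaryGroup (Fin 2) ℂ)}
    {S : Set (GaugeField P j (Matrix.specialUnitaryGroup (Fin 2) ℂ))} (hS : S ∈ 𝓝 U) :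
    ∃ ε₀ : ℝ, 0 < ε₀ ∧ ∀ U' : GaugeField P j (Matrix.specialUnitaryGroup (Fin 2) ℂ),
      (∀ b, ‖((U' b : Matrix.specialUnitaryGroup (Fin 2) ℂ) : Matrix (Fin 2) (Fin 2) ℂ) - (U b : Matrix (Fin 2) (Fin 2) ℂ)‖ < ε₀) →
        U' ∈ S := by
  classical
  obtain ⟨O, hOS, hO, hUO⟩ := mem_nhds_iff.mp hS
  have hO' : IsOpen (O : Set (PBond P j → Matrix.specialUnitaryGroup (Fin 2) ℂ)) := hO
  obtain ⟨u, hu, hpi⟩ := isOpen_pi_iff'.mp hO' U hUO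
  have hr : ∀ b : PBond P j, ∃ r : ℝ, 0 < r ∧ Metric.ball (U b) r ⊆ u b := fun b =>
    Metric.isOpen_iff.mp (hu b).1 (U b) (hu b).2
  choose r hr0 hball using hr
  have hne : (Finset.univ : Finset (PBond P j)).Nonempty := ⟨⟨default, ⟨0, P.hd⟩⟩, Finset.mem_univ _⟩
  refine ⟨Finset.univ.inf' hne r, (Finset.lt_inf'_iff _).mpr fun b _ => hr0 b, fun U' hU' => hOS (hpi ?_)⟩
  refine Set.mem_univ_pi.mpr fun b => hball b ?_
  rw [Metric.mem_ball, Subtype.dist_eq, dist_eq_norm]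
  exact (hU' b).trans_le (Finset.inf'_le r (Finset.mem_univ b))

end Boxes

/-! ## §3 The member-loop map is locally onto along the (0.4) fibre -/

section Main

variable {P : Params} {j : ℕ} [DecidableEq (PBond P j)]

omit [DecidableEq (PBond P j)] in
/-- `‖x⁻¹·m − 1‖ = ‖x − m‖` in `SU(2)` (left multiplication by a unitary is an isometry). [folklore] -/
theorem norm_inv_mul_sub_one (x m : Matrix.specialUnitaryGroup (Fin 2) ℂ) :
    ‖(((x⁻¹ * m : Matrix.specialUnitaryGroup (Fin 2) ℂ)) : Matrix (Fin 2) (Fin 2) ℂ) - 1‖ =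
      ‖(x : Matrix (Fin 2) (Fin 2) ℂ) - (m : Matrix (Fin 2) (Fin 2) ℂ)‖ := by
  have hxu : (x : Matrix (Fin 2) (Fin 2) ℂ) ∈ Matrix.unitaryGroup (Fin 2) ℂ := (Matrix.mem_specialUnitaryGroup_iff.1 x.2).1
  have h1 : (((x⁻¹ * m : Matrix.specialUnitaryGroup (Fin 2) ℂ)) : Matrix (Fin 2) (Fin 2) ℂ) - 1 =
      star (x : Matrix (Fin 2) (Fin 2) ℂ) * ((m : Matrix (Fin 2) (Fin 2) ℂ) - (x : Matrix (Fin 2) (Fin 2) ℂ)) := by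
    rw [Submonoid.coe_mul, mul_sub, Unitary.star_mul_self_of_mem hxu]; rfl
  rw [h1, ← norm_neg ((x : Matrix (Fin 2) (Fin 2) ℂ) - _), neg_sub]
  apply le_antisymm
  · calc _ ≤ ‖star (x : Matrix (Fin 2) (Fin 2) ℂ)‖ * ‖(m : Matrix (Fin 2) (Fin 2) ℂ) - (x : Matrix (Fin 2) (Fin 2) ℂ)‖ := norm_mul_le _ _
      _ = _ := by rw [norm_star, CStarRing.norm_of_mem_unitary hxu, one_mul]
  · have h2 : (m : Matrix (Fin 2) (Fin 2) ℂ) - (x : Matrix (Fin 2) (Fin 2) ℂ) =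
        (x : Matrix (Fin 2) (Fin 2) ℂ) * (star (x : Matrix (Fin 2) (Fin 2) ℂ) * ((m : Matrix (Fin 2) (Fin 2) ℂ) - (x : Matrix (Fin 2) (Fin 2) ℂ))) := by
      rw [← mul_assoc, Unitary.mul_star_self_of_mem hxu, one_mul]
    calc ‖(m : Matrix (Fin 2) (Fin 2) ℂ) - (x : Matrix (Fin 2) (Fin 2) ℂ)‖
        = ‖(x : Matrix (Fin 2) (Fin 2) ℂ) * (star (x : Matrix (Fin 2) (Fin 2) ℂ) * ((m : Matrix (Fin 2) (Fin 2) ℂ) - (x : Matrix (Fin 2) (Fin 2) ℂ)))‖ := by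
          rw [← h2]
      _ ≤ ‖(x : Matrix (Fin 2) (Fin 2) ℂ)‖ * _ := norm_mul_le _ _
      _ = _ := by rw [CStarRing.norm_of_mem_unitary hxu, one_mul]

omit [DecidableEq (PBond P j)] in
/-- `‖g·u − u‖ ≤ ‖g − 1‖` for `u ∈ SU(2)`. [folklore] -/
theorem norm_mul_sub_self_le (g u : Matrix.specialUnitaryGroup (Fin 2) ℂ) :
    ‖(((g * u : Matrix.specialUnitaryGroup (Fin 2) ℂ)) : Matrix (Fin 2) (Fin 2) ℂ) - (u : Matrix (Fin 2) (Fin 2) ℂ)‖ ≤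
      ‖(g : Matrix (Fin 2) (Fin 2) ℂ) - 1‖ := by
  have huu : (u : Matrix (Fin 2) (Fin 2) ℂ) ∈ Matrix.unitaryGroup (Fin 2) ℂ := (Matrix.mem_specialUnitaryGroup_iff.1 u.2).1
  have h1 : (((g * u : Matrix.specialUnitaryGroup (Fin 2) ℂ)) : Matrix (Fin 2) (Fin 2) ℂ) - (u : Matrix (Fin 2) (Fin 2) ℂ) =
      ((g : Matrix (Fin 2) (Fin 2) ℂ) - 1) * (u : Matrix (Fin 2) (Fin 2) ℂ) := by rw [Submonoid.coe_mul, sub_mul, one_mul]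
  rw [h1]
  calc _ ≤ ‖(g : Matrix (Fin 2) (Fin 2) ℂ) - 1‖ * ‖(u : Matrix (Fin 2) (Fin 2) ℂ)‖ := norm_mul_le _ _
    _ = _ := by rw [CStarRing.norm_of_mem_unitary huu, mul_one]

set_option maxHeartbeats 400000 in
/-- **THE MEMBER-LOOP MAP IS OPEN ALONG THE (0.4) FIBRES AT SMALL FIELDS** ((T⊥)(ii) of UV3-NODE §67.7–§67.9 in chart-free
topological form, `SU(2)`).  Let `U` be `δ₁`-small (`((d+2)L)²δ₁∕4 < δ₂`, the regime of ✓`fibrewise_avgFun`) with (0.4) loop variables at `c`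
within `α`, `α < 1∕24`, `α < δ₂∕2`, `800ℓα < κ` (`κ = s′∕|I|`, `ℓ = (d+2)L`); let `i` be a NON-central member whose staircase does not start
with `+e_ν` (`ν ≠ c.dir`).  Then for every `ε > 0` there is `η > 0` such that EVERY `x ∈ SU(2)` with `‖x − loopHol U c i‖ < η` is the
`i`-th loop variable at `c` of a configuration `U′` IN THE FIBRE OF `U` (`Ū(U′) = Ū(U)`, all coarse bonds) that is `ε`-close to `U` bondwise.
Construction: drive the private bond `β(c)` (it moves the member by `pre·g⁻¹·pre⁻¹` on the right and, among the averages, only `Ū(c)`),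
restore `Ū(c)` with the centre leg `⟨emb c₋, ν⟩` (✓`centreLeg_surjective`; invisible to the member and to `U(c)`), restore every other
`Ū(c″)` with its private bond (✓`fibrewise_avgFun`; invisible to `Ū(c)`, to each other, and to the member). [folklore] -/
theorem loopHol_fibre_locally_onto (hj : j + 1 ≤ P.m + P.K) {δ₁ : ℝ} (hδ : 0 ≤ δ₁)
    (hτ : ((((P.d + 2) * P.L : ℕ) : ℝ) ^ 2 / 4) * δ₁ < deltaSU (Fin 2))
    (U : GaugeField P j (Matrix.specialUnitaryGroup (Fin 2) ℂ)) (hU : PlaqSmall δ₁ U)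
    (c : PBond P (j + 1)) {ν : Fin P.d} (hν : ν ≠ c.dir) (i : Idx P) (hic : ¬ IsCentral c i)
    (hiS : (stairWord i.2.1 (off i.1)).head? ≠ some (ν, true))
    {α : ℝ} (hα : ∀ i', dist1 (loopHol U c i') ≤ α) (κ : ℝ)
    (hκ : κ = ((Fintype.card (Idx P) : ℝ))⁻¹ *
      ((Finset.univ.filter fun i' : Idx P => (stairWord i'.2.1 (off i'.1)).head? = some (ν, true)).card : ℝ))
    (hA : α < 1 / 24) (hC : α < deltaSU (Fin 2) / 2) (hD : 800 * (((P.d + 2) * P.L : ℕ) : ℝ) * α < κ)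
    {ε : ℝ} (hε : 0 < ε) :
    ∃ η : ℝ, 0 < η ∧ ∀ x : Matrix.specialUnitaryGroup (Fin 2) ℂ,
      ‖(x : Matrix (Fin 2) (Fin 2) ℂ) - ((loopHol U c i : Matrix.specialUnitaryGroup (Fin 2) ℂ) : Matrix (Fin 2) (Fin 2) ℂ)‖ < η →
        ∃ U' : GaugeField P j (Matrix.specialUnitaryGroup (Fin 2) ℂ),
          (∀ b, ‖((U' b : Matrix.specialUnitaryGroup (Fin 2) ℂ) : Matrix (Fin 2) (Fin 2) ℂ) - (U b : Matrix (Fin 2) (Fin 2) ℂ)‖ < ε) ∧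
          avgFun (expMeanLogSU (n := Fin 2)) U' = avgFun (expMeanLogSU (n := Fin 2)) U ∧ loopHol U' c i = x := by
  classical
  set ℓ : ℝ := (((P.d + 2) * P.L : ℕ) : ℝ) with hℓ
  set e : PBond P j := ⟨emb c.src, ν⟩ with he
  have hℓ0 : 0 ≤ ℓ := Nat.cast_nonneg _
  have hκpos : 0 < κ := by rw [hκ]; exact kappa_pos (P := P) ν
  have hunit : ∀ g : Matrix.specialUnitaryGroup (Fin 2) ℂ, ((g : Matrix (Fin 2) (Fin 2) ℂ)) ∈ Matrix.unitaryGroup (Fin 2) ℂ :=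
    fun g => (Matrix.mem_specialUnitaryGroup_iff.1 g.2).1
  have he_ne : ∀ c3 : PBond P (j + 1), e ≠ centralBond c3 := fun c3 => by rw [he]; exact centreLeg_ne_centralBond hj c c3 ν
  obtain ⟨𝒰, h𝒰o, hU𝒰, -, B, W, hBW, hfib⟩ := OneStepSubmersion.fibrewise_avgFun hj hδ hτ U hU Set.univ isOpen_univ
    (Set.mem_univ _) (fun c2 => {g | ‖(g : Matrix (Fin 2) (Fin 2) ℂ) - (U (centralBond c2) : Matrix (Fin 2) (Fin 2) ℂ)‖ < ε})
    (fun c2 => ⟨isOpen_lt (continuous_subtype_val.sub continuous_const).norm continuous_const, by simpa using hε⟩)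
  obtain ⟨ε₀, hε₀, hbox⟩ := exists_box_subset_of_mem_nhds (h𝒰o.mem_nhds hU𝒰)
  set Cκ : ℝ := 1 + 2 / κ with hCκ
  have h2κ : 0 ≤ 2 / κ := div_nonneg (by norm_num) hκpos.le
  have hCκ1 : 1 ≤ Cκ := by rw [hCκ]; linarith
  have hP1 : 0 ≤ 800 * ℓ * (ℓ + Cκ) := by positivity
  set M : ℝ := Cκ + 48 * ℓ + (2 * ℓ + Cκ) + 800 * ℓ * (ℓ + Cκ) + 1 with hM
  have hM1 : 1 ≤ M := by rw [hM]; linarith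
  set σ : ℝ := min (min (min (1 / 24 - α) (deltaSU (Fin 2) / 2 - α)) (min (κ - 800 * ℓ * α) 1)) (min ε ε₀) with hσ
  have hσ0 : 0 < σ := by
    rw [hσ]; exact lt_min (lt_min (lt_min (by linarith) (by linarith)) (lt_min (by linarith) one_pos)) (lt_min hε hε₀)
  have hσ1 : σ ≤ 1 / 24 - α := by rw [hσ]; exact (min_le_left _ _).trans ((min_le_left _ _).trans (min_le_left _ _))
  have hσ2 : σ ≤ deltaSU (Fin 2) / 2 - α := by rw [hσ]; exact (min_le_left _ _).trans ((min_le_left _ _).trans (min_le_right _ _))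
  have hσ3 : σ ≤ κ - 800 * ℓ * α := by rw [hσ]; exact (min_le_left _ _).trans ((min_le_right _ _).trans (min_le_left _ _))
  have hσ5 : σ ≤ ε := by rw [hσ]; exact (min_le_right _ _).trans (min_le_left _ _)
  have hσ6 : σ ≤ ε₀ := by rw [hσ]; exact (min_le_right _ _).trans (min_le_right _ _)
  set s : ℝ := σ / (2 * M) with hs
  have hs0 : 0 < s := div_pos hσ0 (by linarith)
  have hMs : M * s = σ / 2 := by rw [hs]; field_simp
  have hsσ : ∀ a : ℝ, a ≤ M → a * s < σ := fun a haM => by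
    calc a * s ≤ M * s := mul_le_mul_of_nonneg_right haM hs0.le
      _ = σ / 2 := hMs
      _ < σ := by linarith
  have hCs : (α + s) + 2 * s / κ = α + Cκ * s := by rw [hCκ]; ring
  have hT1 : (α + s) + 2 * s / κ ≤ 1 / 24 := by
    have := hsσ Cκ (by rw [hM]; linarith); rw [hCs]; linarith
  have hT2 : 48 * (ℓ * s) ≤ 1 := by
    have := hsσ (48 * ℓ) (by rw [hM]; linarith)
    have e2 : 48 * (ℓ * s) = (48 * ℓ) * s := by ring
    have hσ4 : σ ≤ 1 := by rw [hσ]; exact (min_le_left _ _).trans ((min_le_right _ _).trans (min_le_right _ _))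
    linarith
  have hT3 : 2 * (ℓ * s) + ((α + s) + 2 * s / κ) < deltaSU (Fin 2) / 2 := by
    have := hsσ (2 * ℓ + Cκ) (by rw [hM]; linarith)
    have e3 : 2 * (ℓ * s) + ((α + s) + 2 * s / κ) = α + (2 * ℓ + Cκ) * s := by rw [hCκ]; ring
    linarith
  have hT4 : 800 * ℓ * (ℓ * s + ((α + s) + 2 * s / κ)) ≤ κ := by
    have := hsσ (800 * ℓ * (ℓ + Cκ)) (by rw [hM]; linarith)
    have e4 : 800 * ℓ * (ℓ * s + ((α + s) + 2 * s / κ)) = 800 * ℓ * α + (800 * ℓ * (ℓ + Cκ)) * s := by rw [hCκ]; ring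
    linarith
  have hCsσ : Cκ * s < σ := hsσ Cκ (by rw [hM]; linarith)
  have hs_le : s ≤ Cκ * s := le_mul_of_one_le_left hs0.le hCκ1
  have h2sκ_le : 2 * s / κ ≤ Cκ * s := by
    have : Cκ * s = s + 2 * s / κ := by rw [hCκ]; ring
    linarith
  have hs_lt_ε : s < ε := by linarith
  have hs_lt_ε₀ : s < ε₀ := by linarith
  have h2sκ_ε : 2 * s / κ < ε := by linarith
  have h2sκ_ε₀ : 2 * s / κ < ε₀ := by linarith
  -- STEP C: continuity of `Ū(·)(c)` at `U`: a box of size `η₁` keeps `Ū(c)` within `s`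
  have hloopsU : ∀ i', dist1 (loopHol U c i') < deltaSU (Fin 2) / 2 := fun i' => (hα i').trans_lt hC
  have hcontU := continuousAt_avgFun_apply (n := Fin 2) U c hloopsU
  have hpre : {U' : GaugeField P j (Matrix.specialUnitaryGroup (Fin 2) ℂ) |
      ‖((avgFun (expMeanLogSU (n := Fin 2)) U' c : Matrix.specialUnitaryGroup (Fin 2) ℂ) : Matrix (Fin 2) (Fin 2) ℂ) -
        ((avgFun (expMeanLogSU (n := Fin 2)) U c : Matrix.specialUnitaryGroup (Fin 2) ℂ) : Matrix (Fin 2) (Fin 2) ℂ)‖ < s} ∈ 𝓝 U := by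
    have hopen : IsOpen {K : Matrix.specialUnitaryGroup (Fin 2) ℂ | ‖(K : Matrix (Fin 2) (Fin 2) ℂ) -
        ((avgFun (expMeanLogSU (n := Fin 2)) U c : Matrix.specialUnitaryGroup (Fin 2) ℂ) : Matrix (Fin 2) (Fin 2) ℂ)‖ < s} :=
      isOpen_lt (continuous_subtype_val.sub continuous_const).norm continuous_const
    exact hcontU.preimage_mem_nhds (hopen.mem_nhds (by simpa using hs0))
  obtain ⟨η₁, hη₁, hbox₁⟩ := exists_box_subset_of_mem_nhds hpre
  refine ⟨min s η₁, lt_min hs0 hη₁, fun x hx => ?_⟩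
  have hxs : ‖(x : Matrix (Fin 2) (Fin 2) ℂ) - ((loopHol U c i : Matrix.specialUnitaryGroup (Fin 2) ℂ) : Matrix (Fin 2) (Fin 2) ℂ)‖ < s := hx.trans_le (min_le_left _ _)
  -- STEP 1: the driver `gβ` on the private bond `β(c)`
  obtain ⟨m, hm⟩ : ∃ m : Matrix.specialUnitaryGroup (Fin 2) ℂ, m = loopHol U c i := ⟨_, rfl⟩
  rw [← hm] at hxs hx
  obtain ⟨gβ, hgβ⟩ : ∃ gβ : Matrix.specialUnitaryGroup (Fin 2) ℂ, gβ = (pre U c)⁻¹ * (x⁻¹ * m) * pre U c := ⟨_, rfl⟩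
  have hdriver : m * (pre U c * gβ⁻¹ * (pre U c)⁻¹) = x := by rw [hgβ]; group
  have hgβ1 : dist1 gβ = ‖(x : Matrix (Fin 2) (Fin 2) ℂ) - (m : Matrix (Fin 2) (Fin 2) ℂ)‖ := by
    have : gβ = (pre U c)⁻¹ * (x⁻¹ * m) * ((pre U c)⁻¹)⁻¹ := by rw [hgβ, inv_inv]
    rw [this, GaugeGroup.dist1_conj, FederbushMean.dist1_SU_eq, norm_inv_mul_sub_one]
  have hgβs : dist1 gβ < s := by rw [hgβ1]; exact hxs
  have hgβn : ‖((gβ : Matrix.specialUnitaryGroup (Fin 2) ℂ) : Matrix (Fin 2) (Fin 2) ℂ) - 1‖ < min s η₁ := by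
    rw [← FederbushMean.dist1_SU_eq, hgβ1]; exact hx
  obtain ⟨U₁, hU₁⟩ : ∃ U₁ : GaugeField P j (Matrix.specialUnitaryGroup (Fin 2) ℂ), U₁ = update U (centralBond c) (gβ * U (centralBond c)) :=
    ⟨_, rfl⟩
  have hU₁b : ∀ b, ‖((U₁ b : Matrix.specialUnitaryGroup (Fin 2) ℂ) : Matrix (Fin 2) (Fin 2) ℂ) - (U b : Matrix (Fin 2) (Fin 2) ℂ)‖ ≤
      ‖((gβ : Matrix.specialUnitaryGroup (Fin 2) ℂ) : Matrix (Fin 2) (Fin 2) ℂ) - 1‖ := by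
    intro b
    by_cases hb : b = centralBond c
    · rw [hb, hU₁, update_self]; exact norm_mul_sub_self_le _ _
    · rw [hU₁, update_of_ne hb, sub_self, norm_zero]; exact norm_nonneg _
  have hα₁ : ∀ i', dist1 (loopHol U₁ c i') ≤ α + s := fun i' => by
    rw [hU₁]
    have := dist1_loopHol_update_centralBond_le hj U c gβ i'
    linarith [hα i', hgβs.le]
  have hK₁ : ‖((avgFun (expMeanLogSU (n := Fin 2)) U₁ c : Matrix.specialUnitaryGroup (Fin 2) ℂ) : Matrix (Fin 2) (Fin 2) ℂ) -
      ((avgFun (expMeanLogSU (n := Fin 2)) U c : Matrix.specialUnitaryGroup (Fin 2) ℂ) : Matrix (Fin 2) (Fin 2) ℂ)‖ < s :=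
    hbox₁ U₁ fun b => (hU₁b b).trans_lt (hgβn.trans_le (min_le_right _ _))
  -- STEP 2: the centre leg restores `Ū(c)`
  obtain ⟨T, hT⟩ : ∃ T : Matrix.specialUnitaryGroup (Fin 2) ℂ, T = avgFun (expMeanLogSU (n := Fin 2)) U c := ⟨_, rfl⟩
  have hTres : ‖(T : Matrix (Fin 2) (Fin 2) ℂ) *
      star ((avgFun (expMeanLogSU (n := Fin 2)) U₁ c : Matrix.specialUnitaryGroup (Fin 2) ℂ) : Matrix (Fin 2) (Fin 2) ℂ) - 1‖ ≤ s := by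
    set K₁ : Matrix (Fin 2) (Fin 2) ℂ := ((avgFun (expMeanLogSU (n := Fin 2)) U₁ c : Matrix.specialUnitaryGroup (Fin 2) ℂ) :
      Matrix (Fin 2) (Fin 2) ℂ) with hK₁def
    have hKu : K₁ ∈ Matrix.unitaryGroup (Fin 2) ℂ := hunit _
    have hid : (T : Matrix (Fin 2) (Fin 2) ℂ) * star K₁ - 1 = ((T : Matrix (Fin 2) (Fin 2) ℂ) - K₁) * star K₁ := by
      rw [sub_mul, Unitary.mul_star_self_of_mem hKu]
    rw [hid]
    calc _ ≤ ‖(T : Matrix (Fin 2) (Fin 2) ℂ) - K₁‖ * ‖star K₁‖ := norm_mul_le _ _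
      _ = ‖K₁ - (T : Matrix (Fin 2) (Fin 2) ℂ)‖ := by rw [norm_star, CStarRing.norm_of_mem_unitary hKu, mul_one, norm_sub_rev]
      _ ≤ s := by rw [hT, hK₁def]; exact hK₁.le
  obtain ⟨g, hg, hK₂⟩ := centreLeg_surjective hj U₁ c hν κ hκ hα₁ hT1 hT2 hT3 hT4 T hTres
  obtain ⟨U₂, hU₂⟩ : ∃ U₂ : GaugeField P j (Matrix.specialUnitaryGroup (Fin 2) ℂ), U₂ = update U₁ e (g * U₁ e) := ⟨_, rfl⟩
  have hU₁e : U₁ e = U e := by rw [hU₁, update_of_ne (he_ne c)]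
  have hU₂b : ∀ b, ‖((U₂ b : Matrix.specialUnitaryGroup (Fin 2) ℂ) : Matrix (Fin 2) (Fin 2) ℂ) - (U b : Matrix (Fin 2) (Fin 2) ℂ)‖ <
      min ε ε₀ := by
    intro b
    by_cases hb : b = e
    · rw [hb, hU₂, update_self, hU₁e]
      exact (norm_mul_sub_self_le _ _).trans_lt (hg.trans_lt (lt_min h2sκ_ε h2sκ_ε₀))
    · rw [hU₂, update_of_ne hb]
      exact (hU₁b b).trans_lt ((hgβn.trans_le (min_le_left _ _)).trans (lt_min hs_lt_ε hs_lt_ε₀))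
  have hU₂𝒰 : U₂ ∈ 𝒰 := hbox U₂ fun b => (hU₂b b).trans_le (min_le_right _ _)
  have hK₂' : avgFun (expMeanLogSU (n := Fin 2)) U₂ c = avgFun (expMeanLogSU (n := Fin 2)) U c := by
    rw [hU₂, he, hK₂, hT]
  -- STEP 3: the private bonds restore every other `Ū(c″)`
  have hsol : ∀ c2 : PBond P (j + 1), ∃ g2 : Matrix.specialUnitaryGroup (Fin 2) ℂ, g2 ∈ B c2 ∧
      avgFun (expMeanLogSU (n := Fin 2)) (update U₂ (centralBond c2) g2) c2 = avgFun (expMeanLogSU (n := Fin 2)) U c2 := by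
    intro c2
    obtain ⟨g2, hg2B, hg2eq⟩ := (hfib U₂ hU₂𝒰 c2).1 (hBW c2).2.2.2
    exact ⟨g2, hg2B, hg2eq⟩
  choose gsol hgsolB hgsol using hsol
  obtain ⟨val, hval⟩ : ∃ val : PBond P (j + 1) → Matrix.specialUnitaryGroup (Fin 2) ℂ,
      val = fun c2 => if c2 = c then U₂ (centralBond c) else gsol c2 := ⟨_, rfl⟩
  obtain ⟨U₃, hU₃⟩ : ∃ U₃ : GaugeField P j (Matrix.specialUnitaryGroup (Fin 2) ℂ), U₃ = Function.extend centralBond val U₂ := ⟨_, rfl⟩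
  have hβinj := centralBond_injective (P := P) (j := j) hj
  have hU₃β : ∀ c2, U₃ (centralBond c2) = val c2 := fun c2 => by rw [hU₃]; exact hβinj.extend_apply _ _ _
  have hU₃off : ∀ b, (¬ ∃ c2, centralBond c2 = b) → U₃ b = U₂ b := fun b hb => by rw [hU₃]; exact Function.extend_apply' _ _ _ hb
  -- `U₃` agrees with `U₂` off the private bonds of `c″ ≠ c`
  have hagree_c : ∀ b : PBond P j, (∀ c3 : PBond P (j + 1), b = centralBond c3 → c3 = c) → U₃ b = U₂ b := by
    intro b hb
    by_cases hex : ∃ c2, centralBond c2 = b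
    · obtain ⟨c2, rfl⟩ := hex
      have := hb c2 rfl; subst this
      rw [hU₃β, hval]; simp
    · exact hU₃off b hex
  have havg : avgFun (expMeanLogSU (n := Fin 2)) U₃ = avgFun (expMeanLogSU (n := Fin 2)) U := by
    funext c2
    by_cases hc2 : c2 = c
    · subst hc2
      rw [avgFun_congr_off_private hj _ U₃ U₂ c2 hagree_c, hK₂']
    · rw [← hgsol c2]
      refine avgFun_congr_off_private hj _ U₃ _ c2 fun b hb => ?_
      by_cases hex : ∃ c3, centralBond c3 = b
      · obtain ⟨c3, rfl⟩ := hex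
        have := hb c3 rfl; subst this
        rw [hU₃β, hval, update_self]; simp [hc2]
      · rw [hU₃off b hex, update_of_ne]
        exact fun h => hex ⟨c2, h.symm⟩
  have hloop : loopHol U₃ c i = x := by
    rw [loopHol_congr_off_private hj U₃ U₂ c hagree_c i, hU₂, he, loopHol_update_centreLeg hj U₁ c hν g i, if_neg hiS, hU₁,
      loopHol_update_centralBond_self hj U c i hic gβ, ← hm]
    exact hdriver
  have hboxε : ∀ b, ‖((U₃ b : Matrix.specialUnitaryGroup (Fin 2) ℂ) : Matrix (Fin 2) (Fin 2) ℂ) - (U b : Matrix (Fin 2) (Fin 2) ℂ)‖ < ε := by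
    intro b
    by_cases hex : ∃ c2, centralBond c2 = b
    · obtain ⟨c2, rfl⟩ := hex
      rw [hU₃β]
      by_cases hc2 : c2 = c
      · subst hc2
        have hv : val c2 = U₂ (centralBond c2) := by simp [hval]
        rw [hv]; exact (hU₂b _).trans_le (min_le_left _ _)
      · have hv : val c2 = gsol c2 := by simp [hval, hc2]
        rw [hv]
        have := (hBW c2).2.1 (hgsolB c2)
        simpa using this
    · rw [hU₃off b hex]; exact (hU₂b b).trans_le (min_le_left _ _)
  exact ⟨U₃, hboxε, havg, hloop⟩

end Main

end Summit.QuantumFields.YangMills.Theorems.FluctuationComparisonRegPrIntLS1aFibreOpenMember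

end
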